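import Mathlib
import Summits.KontsevichZagierPeriods.Zeta5Search.PadicThirdOrder
import Summits.KontsevichZagierPeriods.Zeta5Search.ThirdOrderDigit
import HarnessLib

/-!
# ζ(5) search — the class invariants `φ_x`, `φ₂,x`, `c_x` and the unit `ĝ` TO THIRD ORDER (gen-2 g10, REPORT-gen2-g10 §6.2)

Cell `pub-zeta5` (HONEST FRAMING: systematic search; no irrationality claim unless certified), typer seat generation 12.
Part 2 of the Lean proof of gen-2 g10's CLASSWISE THIRD-DIGIT LEMMA.  For a residue class with base `x < p` and a class point
`q = x + ℓp` (window `b₀ < p²`, so every foreign difference `s − q` is a `p`-adic unit; `p` odd):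

(the generic third-order Taylor estimates `padicNorm_zpow_add_sub_le₃`, `padicNorm_prod_zpow_add_sub_le₃` live in `PadicThirdOrder.lean`)
* `padicNorm_phi2Hat_le_one`, `padicNorm_phi2Hat_sub_le`, `padicNorm_curvHat_le_one`, `padicNorm_curvHat_sub_le` — `φ₂` and
  `c = (φ² − φ₂)/2` are `p`-integral and CLASS-CONSTANT modulo `p`;
* `padicNorm_phiHat_sub_second_le` — **`φ_q ≡ φ_x + ℓ p φ₂,x (mod p²)`**;
* `padicNorm_gHat_sub_third_le` — **`ĝ_q ≡ ĝ_x (1 − ℓ p φ_x + ℓ² p² c_x) (mod p³)`**.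

`p`-adic norms of rational numbers; nothing here concerns irrationality.
-/

noncomputable section

open Finset

namespace Summit.KontsevichZagierPeriods.Zeta5Search.SecondOrder

open Summit.KontsevichZagierPeriods.Zeta5Search.DualSeries (InBox)
open Summit.KontsevichZagierPeriods.Zeta5Search.CasoratianValuation (InPolytope)
open Summit.KontsevichZagierPeriods.Zeta5Search.ClusterValuation
open Summit.KontsevichZagierPeriods.Zeta5Search.PadicSeries
open Summit.KontsevichZagierPeriods.Zeta5Search.CellA (padicNorm_sub_eq_one_of_mod_ne padicNorm_zpow_unit padicNorm_pow_eq
  padicNorm_inv' padicNorm_prod_le_one padicNorm_p)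

variable {p : ℕ} [hp : Fact p.Prime]

/-! ### `φ₂` and `c`: integrality and class-constancy modulo `p` -/

/-- **`φ₂,q` is `p`-integral.** -/
theorem padicNorm_phi2Hat_le_one (b : ℕ → ℤ) (hp2 : p ≠ 2) (q : ℕ) : padicNorm p (phi2Hat b p q) ≤ 1 := by
  unfold phi2Hat
  refine (padicNorm.nonarchimedean (p := p)).trans (max_le ?_ ?_)
  · refine padicNorm.sum_le' (fun s hs => ?_) zero_le_one
    rw [padicNorm.div, padicNorm_pow_eq, padicNorm_sub_eq_one_of_mod_ne (mem_filter.1 hs).2, one_pow, div_one]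
    exact padicNorm.of_int _
  · split_ifs with h
    · rw [padicNorm.div, padicNorm.one, padicNorm_pow_eq, padicNorm_centre_eq_one b hp2 h.2, one_pow, div_one]
    · simp

/-- `‖c_q‖ ≤ 1` (`c = curvHat`, `p` odd). -/
theorem padicNorm_curvHat_le_one (b : ℕ → ℤ) (hp2 : p ≠ 2) (q : ℕ) : padicNorm p (curvHat b p q) ≤ 1 := by
  unfold curvHat
  rw [padicNorm.div, padicNorm_two hp2, div_one]
  refine (padicNorm.sub (p := p)).trans (max_le ?_ (padicNorm_phi2Hat_le_one b hp2 q))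
  rw [padicNorm_pow_eq]
  exact pow_le_one₀ (padicNorm.nonneg _) (padicNorm_phiHat_le_one b hp2 q)

/-- The level displacement `t = x − q = −ℓp` of a class point: `q = x + ℓp`, `‖t‖ ≤ p⁻¹`. -/
theorem class_point_decomp (b : ℕ → ℤ) {x q : ℕ} (hx : x < p) (hq : q ∈ classSet b p x) :
    (q : ℚ) = x + ((q / p : ℕ) : ℚ) * p ∧ padicNorm p (-( ((q / p : ℕ) : ℚ) * p)) ≤ (p : ℚ) ^ (-(1 : ℤ)) := by
  have hqx : q % p = x % p := (mem_filter.1 hq).2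
  refine ⟨?_, ?_⟩
  · have h1 := Nat.div_add_mod q p
    rw [hqx, Nat.mod_eq_of_lt hx] at h1
    have : (q : ℚ) = ((p * (q / p) + x : ℕ) : ℚ) := by rw [h1]
    rw [this]; push_cast; ring
  · rw [padicNorm.neg, padicNorm.mul, padicNorm_p]
    calc padicNorm p ((q / p : ℕ) : ℚ) * (p : ℚ) ^ (-(1 : ℤ)) ≤ 1 * (p : ℚ) ^ (-(1 : ℤ)) :=
          mul_le_mul_of_nonneg_right (by simpa using padicNorm.of_nat (p := p) (q / p)) (zpow_p_nonneg _)
      _ = _ := one_mul _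

/-- **`φ₂` is class-constant modulo `p`**: `‖φ₂,q − φ₂,x‖_p ≤ p⁻¹` for `q` in the class of `x < p`. -/
theorem padicNorm_phi2Hat_sub_le (b : ℕ → ℤ) (hp2 : p ≠ 2) {x q : ℕ} (hx : x < p) (hq : q ∈ classSet b p x) :
    padicNorm p (phi2Hat b p q - phi2Hat b p x) ≤ (p : ℚ) ^ (-(1 : ℤ)) := by
  have hqx : q % p = x % p := (mem_filter.1 hq).2
  obtain ⟨hqdec, ht⟩ := class_point_decomp b hx hq
  set t : ℚ := -(((q / p : ℕ) : ℚ) * p) with htdef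
  have hcen : CentreIn b p q ↔ CentreIn b p x := centreIn_iff_of_mem hq
  set S := (range ((b 0).toNat + 1)).filter (fun s => s % p ≠ x % p) with hS
  have hunit : ∀ s ∈ S, padicNorm p ((s : ℚ) - x) = 1 := fun s hs => padicNorm_sub_eq_one_of_mod_ne (mem_filter.1 hs).2
  have hsq : ∀ s : ℕ, ((s : ℚ) - q) = ((s : ℚ) - x) + t := by intro s; rw [hqdec, htdef]; ring
  have hφq : phi2Hat b p q = (∑ s ∈ S, (netExp b s : ℚ) / ((s : ℚ) - q) ^ 2)
      + (if ¬ (2 : ℤ) ∣ b 0 ∧ ¬ CentreIn b p q then 1 / (((b 0 : ℤ) : ℚ) / 2 - q) ^ 2 else 0) := by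
    rw [phi2Hat, hS, hqx]
  have hφx : phi2Hat b p x = (∑ s ∈ S, (netExp b s : ℚ) / ((s : ℚ) - x) ^ 2)
      + (if ¬ (2 : ℤ) ∣ b 0 ∧ ¬ CentreIn b p x then 1 / (((b 0 : ℤ) : ℚ) / 2 - x) ^ 2 else 0) := rfl
  have e : phi2Hat b p q - phi2Hat b p x =
      (∑ s ∈ S, ((netExp b s : ℚ) / ((s : ℚ) - q) ^ 2 - (netExp b s : ℚ) / ((s : ℚ) - x) ^ 2))
      + ((if ¬ (2 : ℤ) ∣ b 0 ∧ ¬ CentreIn b p q then 1 / (((b 0 : ℤ) : ℚ) / 2 - q) ^ 2 else 0)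
          - (if ¬ (2 : ℤ) ∣ b 0 ∧ ¬ CentreIn b p x then 1 / (((b 0 : ℤ) : ℚ) / 2 - x) ^ 2 else 0)) := by
    rw [hφq, hφx, sum_sub_distrib]; ring
  rw [e]
  refine (padicNorm.nonarchimedean (p := p)).trans (max_le ?_ ?_)
  · refine padicNorm.sum_le' (fun s hs => ?_) (zpow_p_nonneg _)
    rw [hsq s]
    exact padicNorm_div_sq_sub_le (padicNorm.of_int _) (hunit s hs) ht
  · by_cases h : ¬ (2 : ℤ) ∣ b 0 ∧ ¬ CentreIn b p q
    · have h' : ¬ (2 : ℤ) ∣ b 0 ∧ ¬ CentreIn b p x := ⟨h.1, fun hc => h.2 (hcen.2 hc)⟩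
      rw [if_pos h, if_pos h']
      have hc1 := padicNorm_centre_eq_one b hp2 h'.2
      have ec : (((b 0 : ℤ) : ℚ) / 2 - q) = (((b 0 : ℤ) : ℚ) / 2 - x) + t := by rw [hqdec, htdef]; ring
      rw [ec]
      exact padicNorm_div_sq_sub_le (by rw [padicNorm.one]) hc1 ht
    · have h' : ¬ (¬ (2 : ℤ) ∣ b 0 ∧ ¬ CentreIn b p x) := fun hc => h ⟨hc.1, fun hcc => hc.2 (hcen.1 hcc)⟩
      rw [if_neg h, if_neg h', sub_self, padicNorm.zero]; exact zpow_p_nonneg _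

/-- **`c` is class-constant modulo `p`**: `‖c_q − c_x‖_p ≤ p⁻¹`. -/
theorem padicNorm_curvHat_sub_le (b : ℕ → ℤ) (hp2 : p ≠ 2) {x q : ℕ} (hx : x < p) (hq : q ∈ classSet b p x) :
    padicNorm p (curvHat b p q - curvHat b p x) ≤ (p : ℚ) ^ (-(1 : ℤ)) := by
  have e : curvHat b p q - curvHat b p x =
      ((phiHat b p q + phiHat b p x) * (phiHat b p q - phiHat b p x) - (phi2Hat b p q - phi2Hat b p x)) / 2 := by
    unfold curvHat; ring
  rw [e, padicNorm.div, padicNorm_two hp2, div_one]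
  refine (padicNorm.sub (p := p)).trans (max_le ?_ (padicNorm_phi2Hat_sub_le b hp2 hx hq))
  rw [padicNorm.mul]
  have hs : padicNorm p (phiHat b p q + phiHat b p x) ≤ 1 :=
    (padicNorm.nonarchimedean (p := p)).trans (max_le (padicNorm_phiHat_le_one b hp2 q) (padicNorm_phiHat_le_one b hp2 x))
  calc _ ≤ 1 * (p : ℚ) ^ (-(1 : ℤ)) := mul_le_mul hs (padicNorm_phiHat_sub_le b hp2 hq) (padicNorm.nonneg _) zero_le_one
    _ = _ := one_mul _

/-! ### `φ` to second order: `φ_q ≡ φ_x + ℓpφ₂,x (mod p²)` -/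

/-- **`φ_q ≡ φ_x + ℓ p φ₂,x (mod p²)`** for `x < p` and `q = x + ℓp` in the class of `x`. -/
theorem padicNorm_phiHat_sub_second_le (b : ℕ → ℤ) (hp2 : p ≠ 2) {x q : ℕ} (hx : x < p) (hq : q ∈ classSet b p x) :
    padicNorm p (phiHat b p q - (phiHat b p x + ((q / p : ℕ) : ℚ) * p * phi2Hat b p x)) ≤ (p : ℚ) ^ (-(2 : ℤ)) := by
  have hqx : q % p = x % p := (mem_filter.1 hq).2
  obtain ⟨hqdec, ht⟩ := class_point_decomp b hx hq
  set t : ℚ := -(((q / p : ℕ) : ℚ) * p) with htdef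
  have hcen : CentreIn b p q ↔ CentreIn b p x := centreIn_iff_of_mem hq
  set S := (range ((b 0).toNat + 1)).filter (fun s => s % p ≠ x % p) with hS
  have hunit : ∀ s ∈ S, padicNorm p ((s : ℚ) - x) = 1 := fun s hs => padicNorm_sub_eq_one_of_mod_ne (mem_filter.1 hs).2
  have hsq : ∀ s : ℕ, ((s : ℚ) - q) = ((s : ℚ) - x) + t := by intro s; rw [hqdec, htdef]; ring
  have hφq : phiHat b p q = (∑ s ∈ S, (netExp b s : ℚ) / ((s : ℚ) - q))
      + (if ¬ (2 : ℤ) ∣ b 0 ∧ ¬ CentreIn b p q then 1 / (((b 0 : ℤ) : ℚ) / 2 - q) else 0) := by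
    rw [phiHat, hS, hqx]
  have hφx : phiHat b p x = (∑ s ∈ S, (netExp b s : ℚ) / ((s : ℚ) - x))
      + (if ¬ (2 : ℤ) ∣ b 0 ∧ ¬ CentreIn b p x then 1 / (((b 0 : ℤ) : ℚ) / 2 - x) else 0) := rfl
  have hφ2x : phi2Hat b p x = (∑ s ∈ S, (netExp b s : ℚ) / ((s : ℚ) - x) ^ 2)
      + (if ¬ (2 : ℤ) ∣ b 0 ∧ ¬ CentreIn b p x then 1 / (((b 0 : ℤ) : ℚ) / 2 - x) ^ 2 else 0) := rfl
  have hℓt : ((q / p : ℕ) : ℚ) * p = -t := by rw [htdef, neg_neg]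
  rw [hℓt]
  have e : phiHat b p q - (phiHat b p x + -t * phi2Hat b p x) =
      (∑ s ∈ S, ((netExp b s : ℚ) / ((s : ℚ) - q) - ((netExp b s : ℚ) / ((s : ℚ) - x) - t * ((netExp b s : ℚ) / ((s : ℚ) - x) ^ 2))))
      + ((if ¬ (2 : ℤ) ∣ b 0 ∧ ¬ CentreIn b p q then 1 / (((b 0 : ℤ) : ℚ) / 2 - q) else 0)
          - ((if ¬ (2 : ℤ) ∣ b 0 ∧ ¬ CentreIn b p x then 1 / (((b 0 : ℤ) : ℚ) / 2 - x) else 0)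
              - t * (if ¬ (2 : ℤ) ∣ b 0 ∧ ¬ CentreIn b p x then 1 / (((b 0 : ℤ) : ℚ) / 2 - x) ^ 2 else 0))) := by
    rw [hφq, hφx, hφ2x, sum_sub_distrib, sum_sub_distrib, ← mul_sum]; ring
  rw [e]
  refine (padicNorm.nonarchimedean (p := p)).trans (max_le ?_ ?_)
  · refine padicNorm.sum_le' (fun s hs => ?_) (zpow_p_nonneg _)
    rw [hsq s]
    exact padicNorm_div_add_sub_le (padicNorm.of_int _) (hunit s hs) ht
  · by_cases h : ¬ (2 : ℤ) ∣ b 0 ∧ ¬ CentreIn b p q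
    · have h' : ¬ (2 : ℤ) ∣ b 0 ∧ ¬ CentreIn b p x := ⟨h.1, fun hc => h.2 (hcen.2 hc)⟩
      rw [if_pos h, if_pos h', if_pos h']
      have hc1 := padicNorm_centre_eq_one b hp2 h'.2
      have ec : (((b 0 : ℤ) : ℚ) / 2 - q) = (((b 0 : ℤ) : ℚ) / 2 - x) + t := by rw [hqdec, htdef]; ring
      rw [ec]
      exact padicNorm_div_add_sub_le (by rw [padicNorm.one]) hc1 ht
    · have h' : ¬ (¬ (2 : ℤ) ∣ b 0 ∧ ¬ CentreIn b p x) := fun hc => h ⟨hc.1, fun hcc => hc.2 (hcen.1 hcc)⟩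
      rw [if_neg h, if_neg h', if_neg h', mul_zero, sub_zero, sub_self, padicNorm.zero]; exact zpow_p_nonneg _

/-! ### `ĝ` to third order -/

/-- **`ĝ_q ≡ ĝ_x (1 − ℓ p φ_x + ℓ² p² c_x) (mod p³)`** for `x < p` and `q = x + ℓp` in the class of `x` (`ℓ = q / p`),
window `b₀ < p²`, `p` odd. -/
theorem padicNorm_gHat_sub_third_le (b : ℕ → ℤ) (hp2 : p ≠ 2) {x q : ℕ} (hx : x < p) (hq : q ∈ classSet b p x) :
    padicNorm p (gHat b p q - gHat b p x *
      (1 - ((q / p : ℕ) : ℚ) * p * phiHat b p x + (((q / p : ℕ) : ℚ) * p) ^ 2 * curvHat b p x)) ≤ (p : ℚ) ^ (-(3 : ℤ)) := by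
  have hqx : q % p = x % p := (mem_filter.1 hq).2
  have htwo := padicNorm_two (p := p) hp2
  obtain ⟨hqdec, ht⟩ := class_point_decomp b hx hq
  set t : ℚ := -(((q / p : ℕ) : ℚ) * p) with htdef
  have ht1 : padicNorm p t ≤ 1 := ht.trans (zpow_le_one_of_nonpos₀ one_le_p (by norm_num))
  -- the foreign set and the foreign products
  set S := (range ((b 0).toNat + 1)).filter (fun s => s % p ≠ x % p) with hS
  have hunit : ∀ s ∈ S, padicNorm p ((s : ℚ) - x) = 1 := fun s hs => padicNorm_sub_eq_one_of_mod_ne (mem_filter.1 hs).2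
  have hsq : ∀ s ∈ S, ((s : ℚ) - q) = ((s : ℚ) - x) + t := by intro s _; rw [hqdec, htdef]; ring
  set A' := ∏ s ∈ S, ((s : ℚ) - q) ^ netExp b s with hA'
  set A := ∏ s ∈ S, ((s : ℚ) - x) ^ netExp b s with hA
  set Q := ∑ s ∈ S, (netExp b s : ℚ) / ((s : ℚ) - x) with hQ
  set Q₂ := ∑ s ∈ S, (netExp b s : ℚ) / ((s : ℚ) - x) ^ 2 with hQ₂
  have hAQ : padicNorm p (A' - A * (1 + t * Q + t ^ 2 * ((Q ^ 2 - Q₂) / 2))) ≤ (p : ℚ) ^ (-(3 : ℤ)) := by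
    have h := padicNorm_prod_zpow_add_sub_le₃ hp2 S (fun s => ((s : ℚ) - x)) (fun s => netExp b s) hunit ht
    rw [hA', prod_congr rfl fun s hs => by rw [hsq s hs]]
    exact h
  have hA1 : padicNorm p A ≤ 1 := padicNorm_prod_le_one S _ fun s hs => (padicNorm_zpow_unit (hunit s hs) _).le
  have hQ1 : padicNorm p Q ≤ 1 := by
    refine padicNorm.sum_le' (fun s hs => ?_) zero_le_one
    rw [padicNorm.div, hunit s hs, div_one]; exact padicNorm.of_int _
  have hQ₂1 : padicNorm p Q₂ ≤ 1 := by
    refine padicNorm.sum_le' (fun s hs => ?_) zero_le_one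
    rw [padicNorm.div, padicNorm_pow_eq, hunit s hs, one_pow, div_one]; exact padicNorm.of_int _
  have hγ1 : padicNorm p ((Q ^ 2 - Q₂) / 2) ≤ 1 := by
    rw [padicNorm.div, htwo, div_one]
    refine (padicNorm.sub (p := p)).trans (max_le ?_ hQ₂1)
    rw [padicNorm_pow_eq]; exact pow_le_one₀ (padicNorm.nonneg _) hQ1
  -- the two `ĝ`'s, `φ_x`, `c_x` over `S`
  have hcen : CentreIn b p q ↔ CentreIn b p x := centreIn_iff_of_mem hq
  have hgq : gHat b p q = 2 * A' * (if ¬ (2 : ℤ) ∣ b 0 ∧ ¬ CentreIn b p q then ((b 0 : ℤ) : ℚ) / 2 - q else 1) := by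
    rw [gHat, hA', hS, hqx]
  have hgx : gHat b p x = 2 * A * (if ¬ (2 : ℤ) ∣ b 0 ∧ ¬ CentreIn b p x then ((b 0 : ℤ) : ℚ) / 2 - x else 1) := rfl
  have hφx : phiHat b p x = Q + (if ¬ (2 : ℤ) ∣ b 0 ∧ ¬ CentreIn b p x then 1 / (((b 0 : ℤ) : ℚ) / 2 - x) else 0) := rfl
  have hcx : curvHat b p x = ((Q + (if ¬ (2 : ℤ) ∣ b 0 ∧ ¬ CentreIn b p x then 1 / (((b 0 : ℤ) : ℚ) / 2 - x) else 0)) ^ 2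
      - (Q₂ + (if ¬ (2 : ℤ) ∣ b 0 ∧ ¬ CentreIn b p x then 1 / (((b 0 : ℤ) : ℚ) / 2 - x) ^ 2 else 0))) / 2 := rfl
  have hℓt : ((q / p : ℕ) : ℚ) * p = -t := by rw [htdef, neg_neg]
  rw [hgq, hgx, hcx, hφx, hℓt]
  by_cases h : ¬ (2 : ℤ) ∣ b 0 ∧ ¬ CentreIn b p q
  · -- odd `b₀`, centre outside the class: `c' = c + t`
    have h' : ¬ (2 : ℤ) ∣ b 0 ∧ ¬ CentreIn b p x := ⟨h.1, fun hc => h.2 (hcen.2 hc)⟩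
    rw [if_pos h, if_pos h', if_pos h', if_pos h']
    set c : ℚ := ((b 0 : ℤ) : ℚ) / 2 - x with hc
    have hc1 : padicNorm p c = 1 := padicNorm_centre_eq_one b hp2 h'.2
    have hc0 : c ≠ 0 := fun h0 => by rw [h0, padicNorm.zero] at hc1; exact zero_ne_one hc1
    have hc' : ((b 0 : ℤ) : ℚ) / 2 - q = c + t := by rw [hc, hqdec, htdef]; ring
    have hcq1 : padicNorm p (c + t) ≤ 1 := (padicNorm.nonarchimedean (p := p)).trans (max_le hc1.le ht1)
    rw [hc']
    have eI : 2 * A' * (c + t) - 2 * A * c * (1 - -t * (Q + 1 / c) + (-t) ^ 2 * (((Q + 1 / c) ^ 2 - (Q₂ + 1 / c ^ 2)) / 2)) =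
        2 * (c + t) * (A' - A * (1 + t * Q + t ^ 2 * ((Q ^ 2 - Q₂) / 2))) + A * ((Q ^ 2 - Q₂) / 2) * 2 * t ^ 3 := by
      field_simp; ring
    rw [eI]
    refine (padicNorm.nonarchimedean (p := p)).trans (max_le ?_ ?_)
    · rw [padicNorm.mul, padicNorm.mul, htwo, one_mul]
      calc padicNorm p (c + t) * _ ≤ 1 * (p : ℚ) ^ (-(3 : ℤ)) := mul_le_mul hcq1 hAQ (padicNorm.nonneg _) zero_le_one
        _ = _ := one_mul _
    · have h2A : padicNorm p (A * ((Q ^ 2 - Q₂) / 2)) ≤ 1 := by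
        rw [padicNorm.mul]
        calc padicNorm p A * _ ≤ 1 * 1 := mul_le_mul hA1 hγ1 (padicNorm.nonneg _) zero_le_one
          _ = 1 := one_mul 1
      exact padicNorm_mul_mul_cube_le h2A htwo.le ht
  · have h' : ¬ (¬ (2 : ℤ) ∣ b 0 ∧ ¬ CentreIn b p x) := fun hc => h ⟨hc.1, fun hcc => hc.2 (hcen.1 hcc)⟩
    rw [if_neg h, if_neg h', if_neg h', if_neg h']
    have eI : 2 * A' * 1 - 2 * A * 1 * (1 - -t * (Q + 0) + (-t) ^ 2 * (((Q + 0) ^ 2 - (Q₂ + 0)) / 2)) =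
        2 * (A' - A * (1 + t * Q + t ^ 2 * ((Q ^ 2 - Q₂) / 2))) := by ring
    rw [eI, padicNorm.mul, htwo, one_mul]
    exact hAQ

end Summit.KontsevichZagierPeriods.Zeta5Search.SecondOrder

end
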